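import Mathlib
import Literature.MathematicalPhysics.StatisticalMechanics.Crystallization
import Literature.MathematicalPhysics.StatisticalMechanics.SeparatedShellSums
import Literature.MathematicalPhysics.StatisticalMechanics.LennardJonesClusters
import Summits.AtomisticToContinuum.Crystallization.Theorems.BraggSlacknessRigiditySlacknessTransferFourier
import Summits.AtomisticToContinuum.Crystallization.Theorems.BraggSlacknessRigidityHcpDiffractionRigidityDenseCentresAux
import Summits.AtomisticToContinuum.Crystallization.Theorems.BraggSlacknessRigidityHcpDiffractionRigidityDenseCentresAux2
import Summits.AtomisticToContinuum.Crystallization.Theorems.BraggSlacknessRigidityHcpDiffractionRigidityQuietCentresAux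

/-!
# A countable approximating family of admissible test functions
# (stub `stub_admissibleApprox` of crux `HcpDiffractionRigidity`,
# item `stmt-AtomisticToContinuum-13166`, line `registered`)

For a periodic template `P` in `ℝ³` and a hard core `δ > 0` we construct a sequence `hf m` of
admissible test functions (continuous, compactly supported, supported off `0` and off every sphere
through a vector of the dual of the lattice of `P`) such that every admissible `h` is, for every
`ε > 0`, `ε`-close to some `hf m` in the windowed intensity of EVERY finite `δ`-separated
configuration `y` with real weights `c`:
`|∫ h |∑ᵢ cᵢ e^{2πi⟨ξ,yᵢ⟩}|² - ∫ hf m |∑ᵢ cᵢ e^{2πi⟨ξ,yᵢ⟩}|²| ≤ ε ∑ᵢ cᵢ²`.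

Ingredients:
* **weighted Gaussian almost orthogonality** (`integral_gauss_wsf_le`):
  `∫ e^{-π|ξ|²} |∑ᵢ cᵢ e^{2πi⟨ξ,yᵢ⟩}|² = ∑ᵢ∑ⱼ cᵢcⱼ e^{-π|yᵢ-yⱼ|²} ≤ 2(2/δ+1)³ ∑ᵢ cᵢ²`
  (the weighted Gaussian quadratic-form identity `integral_normSq_gaussSum`, `cᵢcⱼ ≤ (cᵢ²+cⱼ²)/2`
  and the Gaussian shell sums `sum_exp_le` over `δ`-separated points), whence
  `|∫ u |S_c|²| ≤ A · 2(2/δ+1)³ ∑ᵢ cᵢ²` whenever `|u| ≤ A e^{-π|ξ|²}` (`abs_integral_wsf_le`);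
* **an admissible exhaustion** (`exists_cutoffs`): cutoffs `χₐ ∈ [0,1]` equal to `1` on the
  compact sets `Kₐ = {|ξ| ≤ a, |‖ξ‖ - ‖k‖| ≥ 1/(a+1) for all dual k}` and supported in the ball of
  radius `a + 1` off `0` and off the Bragg spheres; every admissible support lies in some `Kₐ`
  (uniform gap `exists_gap`);
* **separability of `C(ℝ³, ℝ)`** in the compact-open topology (= topology of compact
  convergence, `ContinuousMap.instSeparableSpace`): a dense sequence `D_b` approximates every
  continuous function uniformly on every compact set (`exists_denseSeq_near`).
The family is `hf ⟨a, b⟩ = χₐ · D_b`; for admissible `h` with support in `Kₐ` and `D_b`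
`η`-close to `h` on the ball of radius `a + 1`, `|h - χₐ D_b| ≤ η ≤ η e^{π(a+1)²} e^{-π|ξ|²}`
everywhere, and almost orthogonality concludes.  All `[folklore]`.
-/

noncomputable section

namespace Summit.AtomisticToContinuum.Crystallization.Theorems

namespace HcpRigidityAdmissibleApprox

open MeasureTheory Complex Metric Set Filter TopologicalSpace
open scoped BigOperators Classical Real RealInnerProductSpace Topology
open Literature.MathematicalPhysics.StatisticalMechanics
open Summit.AtomisticToContinuum.Crystallization.Theorems.BraggSlacknessTransfer
open Summit.AtomisticToContinuum.Crystallization.Theorems.HcpRigidityDenseCentres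
open Summit.AtomisticToContinuum.Crystallization.Theorems.HcpRigidityQuietCentres

/-! ## Weighted structure factors and Gaussian almost orthogonality -/

/-- The weighted structure factor is bounded by the `ℓ¹`-norm of the weights:
`|∑ᵢ cᵢ e^{2πi⟨ξ,yᵢ⟩}| ≤ ∑ᵢ |cᵢ|`. [folklore] -/
theorem norm_wsf_le {n : ℕ} (y : Fin n → EuclideanSpace ℝ (Fin 3)) (c : Fin n → ℝ)
    (ξ : EuclideanSpace ℝ (Fin 3)) :
    ‖∑ i, (c i : ℂ) * cexp (2 * Real.pi * I * (⟪ξ, y i⟫ : ℂ))‖ ≤ ∑ i, |c i| := by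
  refine (norm_sum_le _ _).trans (le_of_eq (Finset.sum_congr rfl fun i _ => ?_))
  rw [norm_mul, Complex.norm_real, Real.norm_eq_abs,
    Literature.NumberTheory.UniformDistribution.norm_cexp_two_pi_mul_ofReal, mul_one]

/-- The weighted structure factor `|∑ᵢ cᵢ e^{2πi⟨ξ,yᵢ⟩}|²` is continuous in `ξ`. [folklore] -/
theorem continuous_wsf {n : ℕ} (y : Fin n → EuclideanSpace ℝ (Fin 3)) (c : Fin n → ℝ) :
    Continuous fun ξ : EuclideanSpace ℝ (Fin 3) =>
      ‖∑ i, (c i : ℂ) * cexp (2 * Real.pi * I * (⟪ξ, y i⟫ : ℂ))‖ ^ 2 := by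
  fun_prop

/-- `e^{-π|ξ|²} |∑ᵢ cᵢ e^{2πi⟨ξ,yᵢ⟩}|²` is integrable. [folklore] -/
theorem integrable_gauss_mul_wsf {n : ℕ} (y : Fin n → EuclideanSpace ℝ (Fin 3)) (c : Fin n → ℝ) :
    Integrable fun ξ : EuclideanSpace ℝ (Fin 3) => Real.exp (-Real.pi * ‖ξ‖ ^ 2) *
      ‖∑ i, (c i : ℂ) * cexp (2 * Real.pi * I * (⟪ξ, y i⟫ : ℂ))‖ ^ 2 := by
  refine (integrable_rexp_neg_mul_sq_norm Real.pi_pos).mul_bdd (c := (∑ i, |c i|) ^ 2)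
    (continuous_wsf y c).aestronglyMeasurable (ae_of_all _ fun ξ => ?_)
  rw [Real.norm_eq_abs, abs_of_nonneg (by positivity)]
  exact pow_le_pow_left₀ (norm_nonneg _) (norm_wsf_le y c ξ) 2

/-- **Weighted Gaussian almost orthogonality.** For a `δ`-separated configuration `y` in `ℝ³`
and real weights `c`, `∫ e^{-π|ξ|²} |∑ᵢ cᵢ e^{2πi⟨ξ,yᵢ⟩}|² dξ ≤ 2(2/δ+1)³ ∑ᵢ cᵢ²`
(`= ∑ᵢ∑ⱼ cᵢcⱼ e^{-π|yᵢ-yⱼ|²} ≤ ∑ᵢ cᵢ² ∑ⱼ e^{-π|yᵢ-yⱼ|²}`). [folklore] -/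
theorem integral_gauss_wsf_le {n : ℕ} (y : Fin n → EuclideanSpace ℝ (Fin 3)) {δ : ℝ} (hδ : 0 < δ)
    (hsep : ∀ i j : Fin n, i ≠ j → δ ≤ dist (y i) (y j)) (c : Fin n → ℝ) :
    ∫ ξ : EuclideanSpace ℝ (Fin 3), Real.exp (-Real.pi * ‖ξ‖ ^ 2) *
        ‖∑ i, (c i : ℂ) * cexp (2 * Real.pi * I * (⟪ξ, y i⟫ : ℂ))‖ ^ 2 ≤
      2 * (2 / δ + 1) ^ 3 * ∑ i, c i ^ 2 := by
  have hW := integral_normSq_gaussSum c (fun _ : Fin n => Real.pi / 2) (fun _ => by positivity) y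
  have hpt : ∀ ξ : EuclideanSpace ℝ (Fin 3),
      ‖∑ i, ((c i * Real.exp (-(Real.pi / 2) * ‖ξ‖ ^ 2) : ℝ) : ℂ) *
        cexp (2 * Real.pi * I * (⟪ξ, y i⟫ : ℂ))‖ ^ 2 =
      Real.exp (-Real.pi * ‖ξ‖ ^ 2) *
        ‖∑ i, (c i : ℂ) * cexp (2 * Real.pi * I * (⟪ξ, y i⟫ : ℂ))‖ ^ 2 := by
    intro ξ
    have h1 : ∑ i, ((c i * Real.exp (-(Real.pi / 2) * ‖ξ‖ ^ 2) : ℝ) : ℂ) *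
        cexp (2 * Real.pi * I * (⟪ξ, y i⟫ : ℂ)) = (Real.exp (-(Real.pi / 2) * ‖ξ‖ ^ 2) : ℂ) *
        ∑ i, (c i : ℂ) * cexp (2 * Real.pi * I * (⟪ξ, y i⟫ : ℂ)) := by
      rw [Finset.mul_sum]
      refine Finset.sum_congr rfl fun i _ => ?_
      push_cast
      ring
    rw [h1, norm_mul, mul_pow, Complex.norm_real, Real.norm_eq_abs, sq_abs, sq, ← Real.exp_add]
    congr 2
    ring
  simp_rw [hpt] at hW
  rw [hW]
  have hbase : Real.pi / (Real.pi / 2 + Real.pi / 2) = 1 := by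
    rw [add_halves]; exact div_self Real.pi_pos.ne'
  have hterm : ∀ i j : Fin n, c i * c j * ((Real.pi / (Real.pi / 2 + Real.pi / 2)) ^ ((3 : ℝ) / 2) *
      Real.exp (-(Real.pi ^ 2 * ‖y i - y j‖ ^ 2 / (Real.pi / 2 + Real.pi / 2)))) =
      c i * c j * Real.exp (-(Real.pi / 1 ^ 2) * ‖y j - y i‖ ^ 2) := by
    intro i j
    rw [hbase, Real.one_rpow, one_mul, norm_sub_rev]
    congr 2
    field_simp
    ring
  simp_rw [hterm]
  have key : ∀ i j : Fin n, c i * c j * Real.exp (-(Real.pi / 1 ^ 2) * ‖y j - y i‖ ^ 2) ≤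
      c i ^ 2 / 2 * Real.exp (-(Real.pi / 1 ^ 2) * ‖y j - y i‖ ^ 2) +
      c j ^ 2 / 2 * Real.exp (-(Real.pi / 1 ^ 2) * ‖y i - y j‖ ^ 2) := by
    intro i j
    rw [norm_sub_rev (y i) (y j), ← add_mul]
    exact mul_le_mul_of_nonneg_right (by nlinarith [sq_nonneg (c i - c j)]) (Real.exp_pos _).le
  calc ∑ i, ∑ j, c i * c j * Real.exp (-(Real.pi / 1 ^ 2) * ‖y j - y i‖ ^ 2)
      ≤ ∑ i, ∑ j, (c i ^ 2 / 2 * Real.exp (-(Real.pi / 1 ^ 2) * ‖y j - y i‖ ^ 2) +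
          c j ^ 2 / 2 * Real.exp (-(Real.pi / 1 ^ 2) * ‖y i - y j‖ ^ 2)) :=
        Finset.sum_le_sum fun i _ => Finset.sum_le_sum fun j _ => key i j
    _ = ∑ i, c i ^ 2 * ∑ j, Real.exp (-(Real.pi / 1 ^ 2) * ‖y j - y i‖ ^ 2) := by
        simp only [Finset.sum_add_distrib]
        rw [Finset.sum_comm (f := fun i j => c j ^ 2 / 2 * Real.exp (-(Real.pi / 1 ^ 2) * ‖y i - y j‖ ^ 2)),
          ← Finset.sum_add_distrib]
        refine Finset.sum_congr rfl fun i _ => ?_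
        rw [← Finset.sum_add_distrib, Finset.mul_sum]
        exact Finset.sum_congr rfl fun j _ => by ring
    _ ≤ ∑ i, c i ^ 2 * (2 * (2 / δ + 1) ^ 3 * 1 ^ 3) := by
        gcongr with i _
        exact sum_exp_le y hδ hsep i le_rfl
    _ = 2 * (2 / δ + 1) ^ 3 * ∑ i, c i ^ 2 := by rw [← Finset.sum_mul]; ring

/-- **Almost orthogonality against a Gaussian-dominated weight.** If `|u| ≤ A e^{-π|ξ|²}`
pointwise, then `|∫ u |∑ᵢ cᵢ e^{2πi⟨ξ,yᵢ⟩}|²| ≤ A · 2(2/δ+1)³ ∑ᵢ cᵢ²` for every `δ`-separated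
`y` and all real weights `c`. [folklore] -/
theorem abs_integral_wsf_le {u : EuclideanSpace ℝ (Fin 3) → ℝ} {A : ℝ} (hA : 0 ≤ A)
    (hu : ∀ ξ, |u ξ| ≤ A * Real.exp (-Real.pi * ‖ξ‖ ^ 2)) {n : ℕ} (y : Fin n → EuclideanSpace ℝ (Fin 3))
    {δ : ℝ} (hδ : 0 < δ) (hsep : ∀ i j : Fin n, i ≠ j → δ ≤ dist (y i) (y j)) (c : Fin n → ℝ) :
    |∫ ξ : EuclideanSpace ℝ (Fin 3), u ξ *
        ‖∑ i, (c i : ℂ) * cexp (2 * Real.pi * I * (⟪ξ, y i⟫ : ℂ))‖ ^ 2| ≤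
      A * (2 * (2 / δ + 1) ^ 3) * ∑ i, c i ^ 2 := by
  have hg := (integrable_gauss_mul_wsf y c).const_mul A
  calc |∫ ξ : EuclideanSpace ℝ (Fin 3), u ξ *
        ‖∑ i, (c i : ℂ) * cexp (2 * Real.pi * I * (⟪ξ, y i⟫ : ℂ))‖ ^ 2|
      ≤ ∫ ξ : EuclideanSpace ℝ (Fin 3), A * (Real.exp (-Real.pi * ‖ξ‖ ^ 2) *
          ‖∑ i, (c i : ℂ) * cexp (2 * Real.pi * I * (⟪ξ, y i⟫ : ℂ))‖ ^ 2) := by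
        rw [← Real.norm_eq_abs]
        refine norm_integral_le_of_norm_le hg (ae_of_all _ fun ξ => ?_)
        rw [Real.norm_eq_abs, abs_mul, abs_of_nonneg (by positivity :
          (0 : ℝ) ≤ ‖∑ i, (c i : ℂ) * cexp (2 * Real.pi * I * (⟪ξ, y i⟫ : ℂ))‖ ^ 2), ← mul_assoc]
        exact mul_le_mul_of_nonneg_right (hu ξ) (by positivity)
    _ = A * ∫ ξ : EuclideanSpace ℝ (Fin 3), Real.exp (-Real.pi * ‖ξ‖ ^ 2) *
          ‖∑ i, (c i : ℂ) * cexp (2 * Real.pi * I * (⟪ξ, y i⟫ : ℂ))‖ ^ 2 := integral_const_mul _ _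
    _ ≤ A * ((2 * (2 / δ + 1) ^ 3) * ∑ i, c i ^ 2) :=
        mul_le_mul_of_nonneg_left (integral_gauss_wsf_le y hδ hsep c) hA
    _ = _ := by ring

/-! ## An admissible exhaustion by cutoffs -/

/-- **Admissible exhaustion by cutoffs.** There are continuous compactly supported cutoffs
`χₐ : ℝ³ → [0,1]`, `a ∈ ℕ`, each supported in the closed ball of radius `a + 1`, off `0` and off
the spheres through the vectors `k` dual to the lattice of `P`, such that every compactly
supported `h` with support off `0` and off those spheres has `χₐ = 1` on its support for some `a`
(`χₐ = 1` on `Kₐ = {|ξ| ≤ a, |‖ξ‖ - ‖k‖| ≥ 1/(a+1) ∀ k dual}`, supported within `3/(4(a+1))`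
of `Kₐ`). [folklore] -/
theorem exists_cutoffs (P : PeriodicConfiguration 3) :
    ∃ χ : ℕ → EuclideanSpace ℝ (Fin 3) → ℝ, (∀ a, Continuous (χ a)) ∧ (∀ a, HasCompactSupport (χ a)) ∧
      (∀ a ξ, 0 ≤ χ a ξ ∧ χ a ξ ≤ 1) ∧
      (∀ a, tsupport (χ a) ⊆ closedBall (0 : EuclideanSpace ℝ (Fin 3)) ((a : ℝ) + 1)) ∧
      (∀ a, ∀ ξ ∈ tsupport (χ a), ξ ≠ 0 ∧ ∀ k : EuclideanSpace ℝ (Fin 3),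
        (∀ g ∈ P.lattice, ∃ m : ℤ, ⟪k, g⟫ = (m : ℝ)) → ‖ξ‖ ≠ ‖k‖) ∧
      (∀ h : EuclideanSpace ℝ (Fin 3) → ℝ, HasCompactSupport h →
        (∀ ξ ∈ tsupport h, ξ ≠ 0 ∧ ∀ k : EuclideanSpace ℝ (Fin 3),
          (∀ g ∈ P.lattice, ∃ m : ℤ, ⟪k, g⟫ = (m : ℝ)) → ‖ξ‖ ≠ ‖k‖) →
        ∃ a, ∀ ξ ∈ tsupport h, χ a ξ = 1) := by
  -- the compact sets `K a`
  set K : ℕ → Set (EuclideanSpace ℝ (Fin 3)) := fun a => closedBall 0 (a : ℝ) ∩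
    {ξ | ∀ k : EuclideanSpace ℝ (Fin 3), (∀ g ∈ P.lattice, ∃ m : ℤ, ⟪k, g⟫ = (m : ℝ)) →
      1 / ((a : ℝ) + 1) ≤ |‖ξ‖ - ‖k‖|} with hK
  have hKc : ∀ a, IsCompact (K a) := by
    intro a
    refine (isCompact_closedBall _ _).inter_right ?_
    simp only [Set.setOf_forall]
    refine isClosed_iInter fun k => isClosed_iInter fun _ => ?_
    exact isClosed_le continuous_const (by fun_prop)
  have hd : ∀ a : ℕ, (0 : ℝ) < 1 / ((a : ℝ) + 1) := fun a => by positivity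
  have hd1 : ∀ a : ℕ, 1 / ((a : ℝ) + 1) ≤ 1 := fun a => by
    rw [div_le_one (by positivity)]; linarith [(Nat.cast_nonneg a : (0 : ℝ) ≤ a)]
  choose χ hχc hχs hχ01 hχ1 hχsupp using fun a => exists_thickCutoff (hKc a) (hd a)
  have h0dual : ∀ g ∈ P.lattice, ∃ m : ℤ, ⟪(0 : EuclideanSpace ℝ (Fin 3)), g⟫ = (m : ℝ) :=
    fun g _ => ⟨0, by simp⟩
  refine ⟨χ, hχc, hχs, hχ01, fun a ξ hξ => ?_, fun a ξ hξ => ?_, fun h hhs hadm => ?_⟩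
  · obtain ⟨t, ht, hξt⟩ := hχsupp a ξ hξ
    have htn : ‖t‖ ≤ a := by simpa using ht.1
    rw [mem_closedBall, dist_zero_right]
    rw [dist_eq_norm] at hξt
    calc ‖ξ‖ ≤ ‖t‖ + ‖ξ - t‖ := norm_le_norm_add_norm_sub' ξ t
      _ ≤ a + 3 * (1 / ((a : ℝ) + 1)) / 4 := add_le_add htn hξt
      _ ≤ a + 1 := by linarith [hd1 a]
  · obtain ⟨t, ht, hξt⟩ := hχsupp a ξ hξ
    rw [dist_eq_norm] at hξt
    have hξt' : |‖ξ‖ - ‖t‖| ≤ 3 * (1 / ((a : ℝ) + 1)) / 4 := (abs_norm_sub_norm_le ξ t).trans hξt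
    have hkey : ∀ k : EuclideanSpace ℝ (Fin 3), (∀ g ∈ P.lattice, ∃ m : ℤ, ⟪k, g⟫ = (m : ℝ)) →
        1 / ((a : ℝ) + 1) / 4 ≤ |‖ξ‖ - ‖k‖| := by
      intro k hk
      have h1 : 1 / ((a : ℝ) + 1) ≤ |‖t‖ - ‖k‖| := ht.2 k hk
      have h2 : |‖t‖ - ‖k‖| ≤ |‖ξ‖ - ‖t‖| + |‖ξ‖ - ‖k‖| := by
        rw [abs_sub_comm ‖ξ‖ ‖t‖]; exact abs_sub_le _ _ _
      linarith
    refine ⟨fun h0 => ?_, fun k hk heq => ?_⟩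
    · have := hkey 0 h0dual
      rw [h0, sub_self, abs_zero] at this
      linarith [hd a]
    · have := hkey k hk
      rw [heq, sub_self, abs_zero] at this
      linarith [hd a]
  · obtain ⟨d, hd0, hgap⟩ := exists_gap P hhs hadm
    obtain ⟨R, hR⟩ := hhs.isCompact.isBounded.subset_closedBall (0 : EuclideanSpace ℝ (Fin 3))
    obtain ⟨a, ha⟩ := exists_nat_ge (max R (1 / d))
    have hRa : R ≤ a := (le_max_left _ _).trans ha
    have hda : 1 / ((a : ℝ) + 1) ≤ d := by
      have h1 : 1 / d ≤ a := (le_max_right _ _).trans ha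
      rw [div_le_iff₀ hd0] at h1
      rw [div_le_iff₀ (by positivity)]
      nlinarith
    refine ⟨a, fun ξ hξ => hχ1 a ξ ⟨ξ, ⟨?_, fun k hk => ?_⟩, ?_⟩⟩
    · exact closedBall_subset_closedBall hRa (hR hξ)
    · exact hda.trans (hgap ξ hξ k hk)
    · rw [dist_self]; exact (half_pos (hd a)).le

/-! ## Uniform approximation on compacts by a dense sequence -/

/-- **Uniform approximation on compacts by a fixed dense sequence.** `C(ℝ³, ℝ)` with the
compact-open topology is separable, and a dense sequence approximates every continuous function
uniformly on every compact set (compact-open = compact convergence). [folklore] -/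
theorem exists_denseSeq_near (f : EuclideanSpace ℝ (Fin 3) → ℝ) (hf : Continuous f)
    {K : Set (EuclideanSpace ℝ (Fin 3))} (hK : IsCompact K) {η : ℝ} (hη : 0 < η) :
    ∃ b : ℕ, ∀ ξ ∈ K, |denseSeq C(EuclideanSpace ℝ (Fin 3), ℝ) b ξ - f ξ| < η := by
  set F : C(EuclideanSpace ℝ (Fin 3), ℝ) := ⟨f, hf⟩ with hF
  have hV : {fg : C(EuclideanSpace ℝ (Fin 3), ℝ) × C(EuclideanSpace ℝ (Fin 3), ℝ) |
      ∀ x ∈ K, (fg.1 x, fg.2 x) ∈ {p : ℝ × ℝ | dist p.1 p.2 < η}} ∈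
      uniformity C(EuclideanSpace ℝ (Fin 3), ℝ) :=
    ContinuousMap.hasBasis_compactConvergenceUniformity.mem_of_mem
      (i := ⟨K, {p : ℝ × ℝ | dist p.1 p.2 < η}⟩) ⟨hK, dist_mem_uniformity hη⟩
  obtain ⟨b, hb⟩ := (denseRange_denseSeq C(EuclideanSpace ℝ (Fin 3), ℝ)).mem_nhds
    (UniformSpace.ball_mem_nhds F hV)
  refine ⟨b, fun ξ hξ => ?_⟩
  have h1 : dist (F ξ) (denseSeq C(EuclideanSpace ℝ (Fin 3), ℝ) b ξ) < η := hb ξ hξ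
  rwa [Real.dist_eq, abs_sub_comm] at h1

end HcpRigidityAdmissibleApprox

open MeasureTheory Complex Metric Set Filter TopologicalSpace
open scoped BigOperators Classical Real RealInnerProductSpace Topology
open HcpRigidityAdmissibleApprox

/-- **STUB A3 — almost orthogonality and a countable approximating family of admissible test
functions.** For any periodic template `P` and hard core `δ > 0` there is a sequence `hf m` of
admissible test functions (continuous, compactly supported, supported off `0` and off the Bragg
spheres of `P`) such that every admissible `h` is, for every `ε > 0`, `ε`-approximated by some
`hf m` in the windowed intensity of every finite `δ`-separated configuration with real weights:
`|∫ h|∑ᵢ cᵢ e^{2πi⟨ξ,yᵢ⟩}|² − ∫ hf m |∑ᵢ cᵢ e^{2πi⟨ξ,yᵢ⟩}|²| ≤ ε ∑ᵢ cᵢ²`. [folklore] -/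
theorem stub_admissibleApprox : ∀ (P : Literature.MathematicalPhysics.StatisticalMechanics.PeriodicConfiguration 3) (δ : ℝ), 0 < δ → ∃ hf : ℕ → (EuclideanSpace ℝ (Fin 3) → ℝ), (∀ m : ℕ, Continuous (hf m) ∧ HasCompactSupport (hf m) ∧ ∀ ξ ∈ tsupport (hf m), ξ ≠ 0 ∧ ∀ k : EuclideanSpace ℝ (Fin 3), (∀ g ∈ P.lattice, ∃ n : ℤ, inner ℝ k g = (n : ℝ)) → ‖ξ‖ ≠ ‖k‖) ∧ ∀ h : EuclideanSpace ℝ (Fin 3) → ℝ, Continuous h → HasCompactSupport h → (∀ ξ ∈ tsupport h, ξ ≠ 0 ∧ ∀ k : EuclideanSpace ℝ (Fin 3), (∀ g ∈ P.lattice, ∃ n : ℤ, inner ℝ k g = (n : ℝ)) → ‖ξ‖ ≠ ‖k‖) → ∀ ε : ℝ, 0 < ε → ∃ m : ℕ, ∀ (n : ℕ) (y : Fin n → EuclideanSpace ℝ (Fin 3)) (c : Fin n → ℝ), (∀ i j : Fin n, i ≠ j → δ ≤ dist (y i) (y j)) → |(∫ ξ, h ξ * ‖∑ i : Fin n, (c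 i : ℂ) * Complex.exp (2 * Real.pi * Complex.I * (inner ℝ ξ (y i) : ℂ))‖ ^ 2) - ∫ ξ, hf m ξ * ‖∑ i : Fin n, (c i : ℂ) * Complex.exp (2 * Real.pi * Complex.I * (inner ℝ ξ (y i) : ℂ))‖ ^ 2| ≤ ε * ∑ i : Fin n, c i ^ 2 := by
  intro P δ hδ
  obtain ⟨χ, hχc, hχs, hχ01, hχball, hχadm, hχexh⟩ := exists_cutoffs P
  refine ⟨fun m ξ => χ (Nat.unpair m).1 ξ * denseSeq C(EuclideanSpace ℝ (Fin 3), ℝ) (Nat.unpair m).2 ξ,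
    fun m => ⟨?_, ?_, fun ξ hξ => hχadm _ ξ (tsupport_mul_subset_left hξ)⟩, ?_⟩
  · exact (hχc _).mul (denseSeq C(EuclideanSpace ℝ (Fin 3), ℝ) (Nat.unpair m).2).continuous
  · exact (hχs _).mul_right
  intro h hhc hhs hadm ε hε
  obtain ⟨a, ha⟩ := hχexh h hhs hadm
  set C : ℝ := 2 * (2 / δ + 1) ^ 3 with hC
  have hC0 : 0 < C := by positivity
  set A : ℝ := Real.exp (Real.pi * ((a : ℝ) + 1) ^ 2) with hA
  have hA0 : 0 < A := Real.exp_pos _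
  set η : ℝ := ε / (A * C) with hη
  have hη0 : 0 < η := by positivity
  obtain ⟨b, hb⟩ := exists_denseSeq_near h hhc
    (isCompact_closedBall (0 : EuclideanSpace ℝ (Fin 3)) ((a : ℝ) + 1)) hη0
  refine ⟨Nat.pair a b, fun n y c hsep => ?_⟩
  simp only [Nat.unpair_pair]
  set g : EuclideanSpace ℝ (Fin 3) → ℝ := fun ξ => denseSeq C(EuclideanSpace ℝ (Fin 3), ℝ) b ξ with hg
  have hgc : Continuous g := (denseSeq C(EuclideanSpace ℝ (Fin 3), ℝ) b).continuous
  -- the support of `h` lies in the ball of radius `a + 1`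
  have hsupp : tsupport h ⊆ closedBall (0 : EuclideanSpace ℝ (Fin 3)) ((a : ℝ) + 1) := by
    intro ξ hξ
    refine hχball a (subset_tsupport _ ?_)
    rw [Function.mem_support, ha ξ hξ]
    exact one_ne_zero
  -- the pointwise bound `|h - χₐ g| ≤ η A e^{-π|ξ|²}`
  have hu : ∀ ξ, |h ξ - χ a ξ * g ξ| ≤ η * A * Real.exp (-Real.pi * ‖ξ‖ ^ 2) := by
    intro ξ
    by_cases hξ : ξ ∈ closedBall (0 : EuclideanSpace ℝ (Fin 3)) ((a : ℝ) + 1)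
    · have hfac : h ξ = χ a ξ * h ξ := by
        by_cases hξ' : ξ ∈ tsupport h
        · rw [ha ξ hξ', one_mul]
        · rw [image_eq_zero_of_notMem_tsupport hξ', mul_zero]
      have h1 : |h ξ - χ a ξ * g ξ| ≤ η := by
        rw [hfac, ← mul_sub, abs_mul, abs_of_nonneg (hχ01 a ξ).1]
        have h2 : |h ξ - g ξ| < η := by rw [abs_sub_comm]; exact hb ξ hξ
        calc χ a ξ * |h ξ - g ξ| ≤ 1 * |h ξ - g ξ| :=
            mul_le_mul_of_nonneg_right (hχ01 a ξ).2 (abs_nonneg _)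
          _ ≤ η := by rw [one_mul]; exact h2.le
      have h2 : 1 ≤ A * Real.exp (-Real.pi * ‖ξ‖ ^ 2) := by
        rw [hA, ← Real.exp_add]
        apply Real.one_le_exp
        rw [mem_closedBall, dist_zero_right] at hξ
        nlinarith [norm_nonneg ξ, Real.pi_pos, pow_le_pow_left₀ (norm_nonneg ξ) hξ 2]
      calc |h ξ - χ a ξ * g ξ| ≤ η * 1 := by rw [mul_one]; exact h1
        _ ≤ η * (A * Real.exp (-Real.pi * ‖ξ‖ ^ 2)) := by gcongr
        _ = _ := by ring
    · have h1 : h ξ = 0 := image_eq_zero_of_notMem_tsupport fun h' => hξ (hsupp h')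
      have h2 : χ a ξ = 0 := image_eq_zero_of_notMem_tsupport fun h' => hξ (hχball a h')
      rw [h1, h2, zero_mul, sub_zero, abs_zero]
      positivity
  -- integrability and conclusion
  have hI1 : Integrable fun ξ : EuclideanSpace ℝ (Fin 3) => h ξ *
      ‖∑ i : Fin n, (c i : ℂ) * Complex.exp (2 * Real.pi * Complex.I * (inner ℝ ξ (y i) : ℂ))‖ ^ 2 :=
    (hhc.mul (continuous_wsf y c)).integrable_of_hasCompactSupport hhs.mul_right
  have hI2 : Integrable fun ξ : EuclideanSpace ℝ (Fin 3) => χ a ξ * g ξ *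
      ‖∑ i : Fin n, (c i : ℂ) * Complex.exp (2 * Real.pi * Complex.I * (inner ℝ ξ (y i) : ℂ))‖ ^ 2 :=
    (((hχc a).mul hgc).mul (continuous_wsf y c)).integrable_of_hasCompactSupport
      ((hχs a).mul_right).mul_right
  rw [← integral_sub hI1 hI2]
  have hfun : (fun ξ : EuclideanSpace ℝ (Fin 3) => h ξ *
      ‖∑ i : Fin n, (c i : ℂ) * Complex.exp (2 * Real.pi * Complex.I * (inner ℝ ξ (y i) : ℂ))‖ ^ 2 -
      χ a ξ * g ξ *
      ‖∑ i : Fin n, (c i : ℂ) * Complex.exp (2 * Real.pi * Complex.I * (inner ℝ ξ (y i) : ℂ))‖ ^ 2) =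
      fun ξ => (h ξ - χ a ξ * g ξ) *
      ‖∑ i : Fin n, (c i : ℂ) * Complex.exp (2 * Real.pi * Complex.I * (inner ℝ ξ (y i) : ℂ))‖ ^ 2 := by
    funext ξ; ring
  rw [hfun]
  have key := abs_integral_wsf_le (by positivity : (0 : ℝ) ≤ η * A) hu y hδ hsep c
  calc _ ≤ η * A * (2 * (2 / δ + 1) ^ 3) * ∑ i, c i ^ 2 := key
    _ = ε * ∑ i, c i ^ 2 := by rw [hη, ← hC]; field_simp

end Summit.AtomisticToContinuum.Crystallization.Theorems

end
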